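import Summits.CriticalPhenomena.PercolationContinuityZ3.Theorems.PercNearOneGluingNoHeavyLowerTailKnQuestion8CoefficientwiseGluing
import HarnessLib

/-!
# Base members of the NO-CORE class: `y ∼ x`, and pieces without a doubly connected colouring — prim-lf-2 gen 55

Support file (`--supports stmt-CriticalPhenomena-4575`, closed), prover `prim-lf-2` (gen 55).  No definitions, no named facts, no sorries; standard axioms.
Memo `prim-lf-2/CW-TWOSOURCESYM-gen55.md` §3; companions `…CoefficientwiseNoCoreSeries.lean` (series closure), `…CoefficientwiseNoCoreDecoration.lean` (decorations).

The class `𝒩` (edge-set form, as in the companions): `(E; x, y) ∈ 𝒩` iff for all monotone `f, g : Set V → ℝ`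
  `0 ≤ Σ_{s ⊆ E : ¬(y ∈ C_x(s) ∧ y ∈ C_x(E∖s))} (f(C_x s) − f(C_x(E∖s)))·(g(C_x s) − g(C_x(E∖s)))`   (`C_x(s) = openCluster (ends '' s) x`; CONJECTURE NO-CORE, gen 46).
* `Coefficientwise.noCore_powerset_of_noDoublePath` — if no colouring of `E` joins `y` to `x` in both colours (e.g. `x = y`'s component of `E` has a bridge separating them, or
  `y` is not joined to `x` at all), the constraint is void and the sum is the two-colouring Harris sum (`harris_twoColouring_powerset`): `(E; x, y) ∈ 𝒩`.
* `Coefficientwise.noCore_powerset_of_nested` — (appended, gen 55) if all admissible colourings have NESTED clusters the sum is termwise `≥ 0` (e.g. the Wheatstone bridge).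
* `Coefficientwise.noCore_powerset_of_adj_root` — if some edge of `E` joins `x` to `y ≠ x`, then `y` always lies in at least one of the two clusters, the event splits as
  `{y ∉ C_x(s)} ⊔ {y ∉ C_x(E∖s)}` and each half is gen 23's off-cluster theorem (`offCluster_twoColouring_nonneg₂_sub` with `A = {y}`): `(E; x, y) ∈ 𝒩` ('NO-CORE = 2·OFF' at a
  root neighbour, gen 46).
With the companions: `𝒩` contains every `(E; x, y)` whose `x–y` block path consists of blocks each containing an edge between its two attachment vertices or having no doubly
connected colouring, with arbitrary finite multigraphs hung at single vertices.
[cite: KozmaNitzan2024, Questions 8–9 (§5.5 p. 36) (context: the Question-8 pocket covariance programme)]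
-/

namespace Summit.CriticalPhenomena.PercolationContinuityZ3.Theorems

open Finset Literature.Probability.Percolation

namespace Coefficientwise

variable {ι V : Type*} [Fintype ι] [DecidableEq ι]

open Classical in
/-- **No doubly connected colouring ⇒ NO-CORE.**  If no `s ⊆ E` joins `y` to `x` in both colours, then `(E; x, y) ∈ 𝒩`: the constraint is void and the sum is the
two-colouring Harris sum on `E.powerset`.  [cite: KozmaNitzan2024, Questions 8–9 (§5.5 p. 36) (context)] -/
theorem noCore_powerset_of_noDoublePath (ends : ι → Sym2 V) (E : Finset ι) (x y : V)
    (hcut : ∀ s, s ⊆ E → y ∈ openCluster (ends '' (↑s : Set ι)) x → y ∉ openCluster (ends '' (↑(E \ s) : Set ι)) x)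
    (f g : Set V → ℝ) (hf : Monotone f) (hg : Monotone g) :
    0 ≤ ∑ s ∈ E.powerset.filter (fun s : Finset ι => ¬ (y ∈ openCluster (ends '' (↑s : Set ι)) x ∧
          y ∈ openCluster (ends '' (↑(E \ s) : Set ι)) x)),
      (f (openCluster (ends '' (↑s : Set ι)) x) - f (openCluster (ends '' (↑(E \ s) : Set ι)) x)) *
        (g (openCluster (ends '' (↑s : Set ι)) x) - g (openCluster (ends '' (↑(E \ s) : Set ι)) x)) := by
  set K : Finset ι → Set V := fun s => openCluster (ends '' (↑s : Set ι)) x with hK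
  change 0 ≤ ∑ s ∈ E.powerset.filter (fun s => ¬ (y ∈ K s ∧ y ∈ K (E \ s))), (f (K s) - f (K (E \ s))) * (g (K s) - g (K (E \ s)))
  have hKmono : ∀ {s t : Finset ι}, s ⊆ t → K s ⊆ K t := fun hst => openCluster_image_mono ends hst x
  have hall : E.powerset.filter (fun s => ¬ (y ∈ K s ∧ y ∈ K (E \ s))) = E.powerset := by
    refine Finset.filter_true_of_mem fun s hs => ?_
    exact fun h => hcut s (Finset.mem_powerset.mp hs) h.1 h.2
  rw [hall]
  exact harris_twoColouring_powerset E (fun s => f (K s)) (fun s => g (K s)) (fun s t hst => hf (hKmono hst)) (fun s t hst => hg (hKmono hst))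

omit [Fintype ι] in
open Classical in
/-- **A root neighbour satisfies NO-CORE** ('NO-CORE = 2·OFF', prim-lf-2 gen 46): if some edge `e ∈ E` has ends `{x, y}` with `y ≠ x`, then `(E; x, y) ∈ 𝒩`.
For every `s ⊆ E` the vertex `y` lies in `C_x(s)` (if `e ∈ s`) or in `C_x(E∖s)` (if not), so the no-core event is the disjoint union of `{y ∉ C_x s}` and `{y ∉ C_x(E∖s)}`, and each
half is the off-cluster theorem with avoided set `{y}` (`offCluster_twoColouring_nonneg₂_sub`), the second after the colour swap `s ↦ E ∖ s`.
[cite: KozmaNitzan2024, Questions 8–9 (§5.5 p. 36) (context)] -/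
theorem noCore_powerset_of_adj_root (ends : ι → Sym2 V) (E : Finset ι) (x y : V) {e : ι} (he : e ∈ E) (hexy : ends e = s(x, y)) (hyx : y ≠ x)
    (f g : Set V → ℝ) (hf : Monotone f) (hg : Monotone g) :
    0 ≤ ∑ s ∈ E.powerset.filter (fun s : Finset ι => ¬ (y ∈ openCluster (ends '' (↑s : Set ι)) x ∧
          y ∈ openCluster (ends '' (↑(E \ s) : Set ι)) x)),
      (f (openCluster (ends '' (↑s : Set ι)) x) - f (openCluster (ends '' (↑(E \ s) : Set ι)) x)) *
        (g (openCluster (ends '' (↑s : Set ι)) x) - g (openCluster (ends '' (↑(E \ s) : Set ι)) x)) := by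
  set K : Finset ι → Set V := fun s => openCluster (ends '' (↑s : Set ι)) x with hK
  change 0 ≤ ∑ s ∈ E.powerset.filter (fun s => ¬ (y ∈ K s ∧ y ∈ K (E \ s))), (f (K s) - f (K (E \ s))) * (g (K s) - g (K (E \ s)))
  -- an edge `e ∈ t` with ends `{x,y}` puts `y` in `C_x(t)`
  have hedge : ∀ t : Finset ι, e ∈ t → y ∈ K t := by
    intro t het
    have hadj : (openGraph (ends '' (↑t : Set ι))).Adj x y := by
      rw [openGraph_image_adj]
      exact ⟨⟨e, het, hexy⟩, hyx.symm⟩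
    exact hadj.reachable
  have hcover : ∀ s, s ⊆ E → y ∈ K s ∨ y ∈ K (E \ s) := by
    intro s hs
    by_cases hes : e ∈ s
    · exact Or.inl (hedge s hes)
    · exact Or.inr (hedge (E \ s) (Finset.mem_sdiff.mpr ⟨he, hes⟩))
  -- split the event
  set X : Finset ι → ℝ := fun s => (f (K s) - f (K (E \ s))) * (g (K s) - g (K (E \ s))) with hX
  have hsplit : ∑ s ∈ E.powerset.filter (fun s => ¬ (y ∈ K s ∧ y ∈ K (E \ s))), X s =
      ∑ s ∈ E.powerset.filter (fun s => y ∉ K s), X s + ∑ s ∈ E.powerset.filter (fun s => y ∉ K (E \ s)), X s := by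
    rw [Finset.sum_filter, Finset.sum_filter, Finset.sum_filter, ← Finset.sum_add_distrib]
    refine Finset.sum_congr rfl fun s hs => ?_
    have hc := hcover s (Finset.mem_powerset.mp hs)
    by_cases h1 : y ∈ K s <;> by_cases h2 : y ∈ K (E \ s)
    · rw [if_neg (fun h => h ⟨h1, h2⟩), if_neg (fun h => h h1), if_neg (fun h => h h2)]; ring
    · rw [if_pos (fun h => h2 h.2), if_neg (fun h => h h1), if_pos h2]; ring
    · rw [if_pos (fun h => h1 h.1), if_pos h1, if_neg (fun h => h h2)]; ring
    · exact absurd hc (by tauto)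
  rw [hsplit]
  -- first half: the off-cluster theorem with avoided set `{y}`
  have hoff : 0 ≤ ∑ s ∈ E.powerset.filter (fun s => y ∉ K s), X s := by
    have key := offCluster_twoColouring_nonneg₂_sub ends E x ({y} : Set V) f f g g hf hf hg hg (fun _ => le_rfl) (fun _ => le_rfl)
    have hfilt : E.powerset.filter (fun t : Finset ι => ∀ a ∈ ({y} : Set V), a ∉ K t) = E.powerset.filter (fun s => y ∉ K s) := by
      refine Finset.filter_congr fun s _ => ?_
      simp only [Set.mem_singleton_iff, forall_eq]
    rw [hfilt] at key
    exact key
  -- second half: the colour swap `s ↦ E ∖ s` turns it into the first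
  have hoff' : 0 ≤ ∑ s ∈ E.powerset.filter (fun s => y ∉ K (E \ s)), X s := by
    have e1 : ∑ s ∈ E.powerset.filter (fun s => y ∉ K (E \ s)), X s = ∑ s ∈ E.powerset.filter (fun s => y ∉ K s), X s := by
      rw [Finset.sum_filter, Finset.sum_filter]
      rw [← sum_powerset_sdiff E (fun t => if y ∉ K t then X t else 0)]
      refine Finset.sum_congr rfl fun s hs => ?_
      have hss : E \ (E \ s) = s := Finset.sdiff_sdiff_eq_self (Finset.mem_powerset.mp hs)
      refine if_congr Iff.rfl ?_ rfl
      simp only [hX, hss]; ring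
    rw [e1]; exact hoff
  exact add_nonneg hoff hoff'


omit [Fintype ι] in
open Classical in
/-- **Nested clusters ⇒ NO-CORE (termwise).**  If for every colouring `s ⊆ E` not joining `y` to `x` in both colours the two clusters of `x` are `⊆`-comparable, then every summand
`(f(C_x s) − f(C_x(E∖s)))(g(C_x s) − g(C_x(E∖s)))` of the NO-CORE sum is a product of two numbers of the same sign, so `(E; x, y) ∈ 𝒩`.  Example (prim-lf-2 gen 55): the Wheatstone
bridge `x–a, x–b, a–b, a–y, b–y` with terminals `x, y` (all 28 admissible colourings have nested clusters) — the first two-terminal graph outside the series/decoration/tame-parallel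
closure.  [cite: KozmaNitzan2024, Questions 8–9 (§5.5 p. 36) (context)] -/
theorem noCore_powerset_of_nested (ends : ι → Sym2 V) (E : Finset ι) (x y : V)
    (hnest : ∀ s, s ⊆ E → ¬ (y ∈ openCluster (ends '' (↑s : Set ι)) x ∧ y ∈ openCluster (ends '' (↑(E \ s) : Set ι)) x) →
      (openCluster (ends '' (↑s : Set ι)) x ⊆ openCluster (ends '' (↑(E \ s) : Set ι)) x ∨
        openCluster (ends '' (↑(E \ s) : Set ι)) x ⊆ openCluster (ends '' (↑s : Set ι)) x))
    (f g : Set V → ℝ) (hf : Monotone f) (hg : Monotone g) :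
    0 ≤ ∑ s ∈ E.powerset.filter (fun s : Finset ι => ¬ (y ∈ openCluster (ends '' (↑s : Set ι)) x ∧
          y ∈ openCluster (ends '' (↑(E \ s) : Set ι)) x)),
      (f (openCluster (ends '' (↑s : Set ι)) x) - f (openCluster (ends '' (↑(E \ s) : Set ι)) x)) *
        (g (openCluster (ends '' (↑s : Set ι)) x) - g (openCluster (ends '' (↑(E \ s) : Set ι)) x)) := by
  refine Finset.sum_nonneg fun s hs => ?_
  obtain ⟨hsE, hnc⟩ := Finset.mem_filter.mp hs
  rcases hnest s (Finset.mem_powerset.mp hsE) hnc with h | h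
  · exact mul_nonneg_of_nonpos_of_nonpos (by linarith [hf h]) (by linarith [hg h])
  · exact mul_nonneg (by linarith [hf h]) (by linarith [hg h])

end Coefficientwise

end Summit.CriticalPhenomena.PercolationContinuityZ3.Theorems
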